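import Literature.Topology.FourManifolds.KhTriangleIso
import Literature.Topology.FourManifolds.KhOmega3Degenerate
import Literature.Topology.FourManifolds.KhBigonRotate
import Literature.Topology.FourManifolds.KhResolutionsDichotomyProofs
import Literature.Topology.FourManifolds.GaussDiagramParityProofs
import HarnessLib

/-!
# Khovanov homology is invariant under the Polyak moves between knot diagrams

Sibling file of `KhComplex.lean`, assembling the per-move invariance theorems of the programme
and **discharging the named fact**
`Literature.Topology.FourManifolds.GaussDiagram.nonempty_iso_khovanovHomology_of_equiv`
(`nonempty_iso_khovanovHomology_of_equiv_holds`): two realisable Gauss diagrams related by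
Polyak's Reidemeister moves have isomorphic Khovanov homology in every bidegree
(Khovanov (2000), Thm. 1).

* `nonempty_iso_khovanovHomology_of_polyakMove` — if `PolyakMove G G'` and both `G` and `G'`
  are Gauss diagrams of knots, then `Kh^{i,j}(G) ≅ Kh^{i,j}(G')`, by cases on the move:
  `relabel` (`nonempty_iso_khovanovHomology_of_isRelabelling`), `Ω1a/Ω1b` (`KhCurlRotate.lean`,
  no hypothesis needed), `Ω2a` (`KhBigonRotate.lean`, realisability of the target), `Ω3a` with
  `x ≠ z` (`KhTriangleIso.lean`, realisability of both sides) and the degenerate `x = z`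
  (`KhOmega3Degenerate.lean`, no hypothesis needed).
* `nonempty_iso_khovanovHomology_of_polyakMove_of_allEven` — the same for a Polyak move between
  *all-even* Gauss diagrams (`GaussDiagram.AllEven`, Gauss's parity condition): the per-move
  theorems only use the merge-or-split dichotomy of the cube of resolutions, which holds for
  every all-even diagram (`isMergeAt_or_isSplitAt_of_overPos_mod_two_ne`,
  `KhResolutionsDichotomyProofs`; Viro (2004), §5.2).
* `nonempty_iso_khovanovHomology_of_evenEquiv` — hence `Kh^{i,j}` is invariant along every chain
  of Polyak moves through all-even diagrams (`GaussDiagram.EvenEquiv`).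
* `nonempty_iso_khovanovHomology_of_equiv_holds` — the discharge. `GaussDiagram.Equiv` is
  generated by Polyak moves through arbitrary — possibly non-realisable — intermediate Gauss
  diagrams, for which the cube of resolutions need not be a complex; the gap is closed by
  Manturov's projection theorem (`GaussDiagram.evenEquiv_of_equiv`, `GaussDiagramParity`;
  Manturov (2012), §3.2, Thm. 2: deleting the odd chords maps a chain of moves to a chain of moves
  through all-even diagrams and fixes all-even diagrams) together with Gauss's parity condition
  for diagrams of knots (`Knot.HasGaussDiagram.allEven`, Kauffman (1999), §3.2, Lemma 1). This
  replaces the detour through Goussarov–Polyak–Viro (2000), Thm. 1.B and Reidemeister's theorem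
  mentioned on the named fact.

No named fact is introduced here.

## References

* M. Khovanov, *A categorification of the Jones polynomial*, Duke Math. J. 101 (2000) 359–426,
  §5, Thm. 1. [cite: Khovanov2000, Thm. 1]
* D. Bar-Natan, *On Khovanov's categorification of the Jones polynomial*, Algebr. Geom. Topol. 2
  (2002) 337–370, §4. [cite: BarNatan2002, §4]
* M. Polyak, *Minimal generating sets of Reidemeister moves*, Quantum Topol. 1 (2010), Thm. 1.1.
  [cite: Polyak2010, Thm. 1.1]
* V. O. Manturov, *Free knots and parity*, in: Introductory Lectures on Knot Theory, Ser. Knots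
  Everything 46, World Scientific (2012) 321–345, §3.2, Thm. 2. [cite: Manturov2011, §3.2 Thm. 2]
* L. H. Kauffman, *Virtual knot theory*, European J. Combin. 20 (1999) 663–690, §3.2, Lemma 1.
  [cite: Kauffman1999, §3.2 Lemma 1]
* O. Viro, *Virtual links, orientations of chord diagrams and Khovanov homology*, Proceedings of
  the Gökova Geometry–Topology Conference 2005, 187–212, §5.2. [cite: Viro2004, §5.2]
-/

open CategoryTheory

noncomputable section

namespace Literature.Topology.FourManifolds

namespace GaussDiagram

/-- **Khovanov homology is invariant under every single Polyak move between Gauss diagrams of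
knots**: if `PolyakMove G G'` and both sides are realised by knots then
`Kh^{i,j}(G) ≅ Kh^{i,j}(G')` for all `i, j`. Khovanov (2000), Thm. 1 (per move: §5.1 `Ω1`,
§5.3 `Ω2`, §5.4 `Ω3`, §3.3 renumbering); Bar-Natan (2002), §4. [cite: Khovanov2000, Thm. 1] -/
theorem nonempty_iso_khovanovHomology_of_polyakMove {G G' : GaussDiagram} (h : PolyakMove G G')
    (hG : ∃ K : Knot, K.HasGaussDiagram G) (hG' : ∃ K : Knot, K.HasGaussDiagram G') (i j : ℤ) :
    Nonempty (G.khovanovHomology i j ≅ G'.khovanovHomology i j) := by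
  cases h
  case relabel hrel => exact nonempty_iso_khovanovHomology_of_isRelabelling hrel i j
  case omega1a p ε => exact G.nonempty_iso_khovanovHomology_omega1a p ε i j
  case omega1b p ε => exact G.nonempty_iso_khovanovHomology_omega1b p ε i j
  case omega2a o u o' u' ε hover hunder =>
    exact G.nonempty_iso_khovanovHomology_omega2a_of_hasGaussDiagram o u o' u' ε hover hunder hG' i j
  case omega3a x y z hx hy hz ha hb hc =>
    by_cases hxz : x = z
    · subst hxz
      exact G.nonempty_iso_khovanovHomology_omega3a_degenerate ha hb hc i j
    · exact G.nonempty_iso_khovanovHomology_omega3a_of_hasGaussDiagram hxz ha hb hc hx hy hz hG hG' i j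

/-- **Khovanov homology is invariant under the symmetric closure of the Polyak moves between
Gauss diagrams of knots.** [cite: Khovanov2000, Thm. 1] -/
theorem nonempty_iso_khovanovHomology_of_polyakMove_symm {G G' : GaussDiagram} (h : PolyakMove G' G)
    (hG : ∃ K : Knot, K.HasGaussDiagram G) (hG' : ∃ K : Knot, K.HasGaussDiagram G') (i j : ℤ) :
    Nonempty (G.khovanovHomology i j ≅ G'.khovanovHomology i j) := by
  obtain ⟨e⟩ := nonempty_iso_khovanovHomology_of_polyakMove h hG' hG i j
  exact ⟨e.symm⟩

/-- **Khovanov homology is invariant along every chain of Polyak moves through Gauss diagrams of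
knots**: the equivalence relation generated by Polyak moves *restricted to realisable Gauss
diagrams* preserves `Kh^{i,j}`. (The named fact `nonempty_iso_khovanovHomology_of_equiv` asks
this for `GaussDiagram.Equiv`, whose chains may pass through non-realisable diagrams.)
[cite: Khovanov2000, Thm. 1] -/
theorem nonempty_iso_khovanovHomology_of_eqvGen_realisable {G G' : GaussDiagram}
    (h : Relation.EqvGen (fun A B ↦ PolyakMove A B ∧ (∃ K : Knot, K.HasGaussDiagram A) ∧
      (∃ K : Knot, K.HasGaussDiagram B)) G G') (i j : ℤ) :
    Nonempty (G.khovanovHomology i j ≅ G'.khovanovHomology i j) := by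
  induction h with
  | rel A B hAB => exact nonempty_iso_khovanovHomology_of_polyakMove hAB.1 hAB.2.1 hAB.2.2 i j
  | refl A => exact ⟨Iso.refl _⟩
  | symm A B _ ih => obtain ⟨e⟩ := ih; exact ⟨e.symm⟩
  | trans A B C _ _ ih₁ ih₂ => obtain ⟨e₁⟩ := ih₁; obtain ⟨e₂⟩ := ih₂; exact ⟨e₁ ≪≫ e₂⟩

/-! ## All-even diagrams: from single Polyak moves to `GaussDiagram.Equiv` -/

/-- **Khovanov homology is invariant under every single Polyak move between all-even Gauss
diagrams**: if `PolyakMove G G'` and every chord of `G` and of `G'` is even (Gauss's parity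
condition) then `Kh^{i,j}(G) ≅ Kh^{i,j}(G')` for all `i, j`. The per-move homotopy equivalences
(Khovanov (2000), §5; Bar-Natan (2002), §4) only use that every edge of the cube of resolutions is
a merge or a split, which holds for all-even diagrams (`isMergeAt_or_isSplitAt_of_overPos_mod_two_ne`,
Viro (2004), §5.2). Khovanov (2000), Thm. 1 (per move: §5.1 `Ω1`, §5.3 `Ω2`, §5.4 `Ω3`, §3.3
renumbering). [cite: Khovanov2000, Thm. 1] -/
theorem nonempty_iso_khovanovHomology_of_polyakMove_of_allEven {G G' : GaussDiagram} (h : PolyakMove G G')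
    (hG : G.AllEven) (hG' : G'.AllEven) (i j : ℤ) :
    Nonempty (G.khovanovHomology i j ≅ G'.khovanovHomology i j) := by
  cases h
  case relabel hrel => exact nonempty_iso_khovanovHomology_of_isRelabelling hrel i j
  case omega1a p ε => exact G.nonempty_iso_khovanovHomology_omega1a p ε i j
  case omega1b p ε => exact G.nonempty_iso_khovanovHomology_omega1b p ε i j
  case omega2a o u o' u' ε hover hunder =>
    exact G.nonempty_iso_khovanovHomology_omega2a o u o' u' ε hover hunder
      (fun _ _ hτ ↦ isMergeAt_or_isSplitAt_of_overPos_mod_two_ne hG' hτ) i j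
  case omega3a x y z hx hy hz ha hb hc =>
    by_cases hxz : x = z
    · subst hxz
      exact G.nonempty_iso_khovanovHomology_omega3a_degenerate ha hb hc i j
    · exact G.nonempty_iso_khovanovHomology_omega3a hxz ha hb hc hx hy hz
        (fun _ _ hτ ↦ isMergeAt_or_isSplitAt_of_overPos_mod_two_ne hG hτ)
        (fun _ _ hτ ↦ isMergeAt_or_isSplitAt_of_overPos_mod_two_ne hG' hτ) i j

/-- **Khovanov homology is invariant under a Polyak move between all-even diagrams**
(`GaussDiagram.EvenMove`). [cite: Khovanov2000, Thm. 1] -/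
theorem nonempty_iso_khovanovHomology_of_evenMove {G G' : GaussDiagram} (h : EvenMove G G') (i j : ℤ) :
    Nonempty (G.khovanovHomology i j ≅ G'.khovanovHomology i j) :=
  nonempty_iso_khovanovHomology_of_polyakMove_of_allEven h.1 h.2.1 h.2.2 i j

/-- **Khovanov homology is invariant along every chain of Polyak moves through all-even Gauss
diagrams** (`GaussDiagram.EvenEquiv`, the equivalence generated by `EvenMove`).
[cite: Khovanov2000, Thm. 1] -/
theorem nonempty_iso_khovanovHomology_of_evenEquiv {G G' : GaussDiagram} (h : EvenEquiv G G') (i j : ℤ) :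
    Nonempty (G.khovanovHomology i j ≅ G'.khovanovHomology i j) := by
  induction h with
  | rel A B hAB => exact nonempty_iso_khovanovHomology_of_evenMove hAB i j
  | refl A => exact ⟨Iso.refl _⟩
  | symm A B _ ih => obtain ⟨e⟩ := ih; exact ⟨e.symm⟩
  | trans A B C _ _ ih₁ ih₂ => obtain ⟨e₁⟩ := ih₁; obtain ⟨e₂⟩ := ih₂; exact ⟨e₁ ≪≫ e₂⟩

/-- **Khovanov homology is invariant under `GaussDiagram.Equiv` between all-even diagrams**:
two all-even Gauss diagrams related by Polyak moves through arbitrary (possibly non-realisable,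
possibly odd) intermediate diagrams are related by Polyak moves through all-even diagrams
(Manturov's projection theorem `evenEquiv_of_equiv`, Manturov (2012), §3.2, Thm. 2), along which
`Kh^{i,j}` is invariant. [cite: Manturov2011, §3.2 Thm. 2] -/
theorem nonempty_iso_khovanovHomology_of_equiv_of_allEven {G G' : GaussDiagram} (hG : G.AllEven)
    (hG' : G'.AllEven) (e : G.Equiv G') (i j : ℤ) :
    Nonempty (G.khovanovHomology i j ≅ G'.khovanovHomology i j) :=
  nonempty_iso_khovanovHomology_of_evenEquiv (evenEquiv_of_equiv hG hG' e) i j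

/-- **Invariance of Khovanov homology** — discharge of the named fact
`nonempty_iso_khovanovHomology_of_equiv` of `KhComplex`: two *realisable* Gauss diagrams
related by Polyak's Reidemeister moves (`GaussDiagram.Equiv`, possibly through non-realisable
diagrams) have isomorphic Khovanov homology in every bidegree. Proof: Gauss diagrams of knots are
all-even (Gauss's parity condition, `Knot.HasGaussDiagram.allEven`, Kauffman (1999), §3.2,
Lemma 1); equivalent all-even diagrams are equivalent through all-even diagrams (Manturov's
projection theorem, `evenEquiv_of_equiv`); and Khovanov homology is invariant under every
Polyak move between all-even diagrams, by the explicit chain-homotopy equivalences of Khovanov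
(2000), §5 (`KhCurlRotate`, `KhBigonRotate`, `KhTriangleIso`, `KhOmega3Degenerate`) and the
renumbering isomorphism of §3.3 (`KhComplexTransportProofs`). Khovanov (2000), Thm. 1;
Bar-Natan (2002), Thm. 2. [cite: Khovanov2000, Thm. 1] -/
theorem nonempty_iso_khovanovHomology_of_equiv_holds : nonempty_iso_khovanovHomology_of_equiv := by
  intro G G' hG hG' e i j
  obtain ⟨K, hK⟩ := hG
  obtain ⟨K', hK'⟩ := hG'
  exact nonempty_iso_khovanovHomology_of_equiv_of_allEven hK.allEven hK'.allEven e i j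

end GaussDiagram

end Literature.Topology.FourManifolds
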